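import Summits.PneNP.PneNP.Theses.RamseyUncertifiable
import Literature.Computability.Complexity.HamCircuitNP
import Literature.Computability.Complexity.CodeFPStrings

/-!
# Route `RamseyUncertifiable`, support `RamseyInCoNP`: RAMSEY₂ ∈ coNP

Item `stmt-PneNP-9819` of route `PneNP/RamseyUncertifiable`
(`Summit.PneNP.PneNP.Theses.RamseyUncertifiable.RamseyInCoNP`): the language of adjacency codes
`encodingGraph.encode ⟨n, G⟩` of the graphs with neither a clique nor an independent set of size
`k(n) = ⌈2 log₂ n⌉ = Nat.clog 2 (n ^ 2)` is in `coNP = co NP`.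

Proof (folklore; Arora–Barak 2009, Def. 2.1/2.19 and §2.6.1 on invalid encodings; the certificate is
Karp's CLIQUE certificate, Karp 1972 §4 problem 3): the COMPLEMENT of the language is
`(HamNP.gcodeLang)ᶜ ⊔ W` — a string outside the language is either not the code of a graph
(`HamNP.gcodeLang ∈ P`, `HamCircuitNP.lean`) or the code of a graph carrying a homogeneous
`k(n)`-set, and `W = {x | ∃ y, |y| ≤ |x| ∧ chk ⟨x, y⟩}` is the certificate language of the verifier
`chk` accepting `⟨⟨bin n, bits⟩, y⟩` iff the witness `y` is the characteristic vector of a set of at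
least `k(n) = Nat.size (n·n − 1)` vertices that is a clique or an independent set of the bit matrix.
The verifier is assembled in the tree's typed calculus of polynomial-time maps on codes (`CodeFP`,
`CodeFP.lean` / `CodeFPArith.lean` / `CodeFPStrings.lean`: numerals, bit access, `all` over a range);
no machine is written. Then `union_P_mem_polyExists` (`NPClosureProofs.lean`).

References: R. M. Karp, *Reducibility among combinatorial problems*, 1972, §3 Def. 4, §4 (CLIQUE);
S. Arora, B. Barak, *Computational Complexity: A Modern Approach*, CUP 2009, Def. 2.1, Def. 2.19–2.20,
§2.6.1; M. Lauria, P. Pudlák, V. Rödl, N. Thapen, *The complexity of proving that a graph is Ramsey*,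
Combinatorica 37 (2017) / arXiv:1303.3166, §1 (RAMSEY₂ as a decision problem).
-/

-- `Summit.PneNP.PneNP.…` duplicates `PneNP` BY DESIGN (single-problem summit, D-0017).
set_option linter.dupNamespace false

namespace Summit.PneNP.PneNP.Theorems

open Literature.Computability.Complexity Literature.Computability.Complexity.CodeFP
open _root_.Computability Brick Polynomial Finset

namespace RamseyUncertifiableRamseyInCoNP

/-! ### The threshold `k(n) = ⌈log₂ (n²)⌉` as a numeral computation -/

/-- `Nat.size (m - 1) = ⌈log₂ m⌉` (`Nat.size m = ⌈log₂ (m + 1)⌉`; both sides vanish at `m = 0`).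
[folklore] -/
theorem size_pred_eq_clog (m : ℕ) : Nat.size (m - 1) = Nat.clog 2 m := by
  rcases Nat.eq_zero_or_pos m with rfl | hm
  · simp
  · apply le_antisymm
    · refine Nat.size_le.2 ?_
      have := Nat.le_pow_clog one_lt_two m
      omega
    · refine (Nat.clog_le_iff_le_pow one_lt_two).2 ?_
      have := Nat.lt_size_self (m - 1)
      omega

/-- The route's threshold: `Nat.size (n·n − 1) = Nat.clog 2 (n ^ 2)`. [folklore] -/
theorem size_mul_self_pred (n : ℕ) : Nat.size (n * n - 1) = Nat.clog 2 (n ^ 2) := by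
  rw [size_pred_eq_clog, sq]

/-! ### The pair test over the flat indices of the bit matrix -/

/-- **The pair test at every flat index `t = i·n + j < n²`** — "two distinct chosen vertices
`i = t / n`, `j = t % n` have adjacency bit `pol`" — holds iff it holds at every pair `(i, j)`.
[cite: Karp1972, §4 Main Theorem, problem 3] -/
theorem all_range_iff (pol : Bool) (n : ℕ) (bits y : List Bool) :
    ((List.range (n * n)).all fun t =>
        !(y.getD (t / n) false && (y.getD (t % n) false && !decide (t / n = t % n))) ||
          (bits.getD t false == pol)) = true ↔
      ∀ i j : Fin n, y.getD i false = true → y.getD j false = true → i ≠ j →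
        bits.getD (i * n + j) false = pol := by
  rw [List.all_eq_true]
  constructor
  · intro h i j hi hj hij
    have ht := h _ (List.mem_range.2 (CliqueNP.flat_lt i j))
    rw [CliqueNP.flat_div, CliqueNP.flat_mod, hi, hj] at ht
    have hne : ¬ ((i : ℕ) = j) := fun e => hij (Fin.ext e)
    simpa [hne] using ht
  · intro h t ht
    rw [List.mem_range] at ht
    by_cases hd : t / n = t % n
    · simp [hd]
    · cases hi : y.getD (t / n) false
      · simp
      · cases hj : y.getD (t % n) false
        · simp
        · have e := h ⟨t / n, CliqueNP.div_lt_of_lt_mul ht⟩ ⟨t % n, Nat.mod_lt _ (CliqueNP.pos_of_lt_mul ht)⟩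
            hi hj (fun e => hd (congrArg Fin.val e))
          dsimp only at e
          rw [Nat.div_add_mod' t n] at e
          simpa [hd] using e

/-! ### Characteristic vectors of homogeneous sets -/

/-- **A graph has a `k`-clique iff some bit vector of length `n` with at least `k` ones chooses
pairwise adjacent vertices** (the vector of a `k`-clique; conversely a chosen set of `≥ k` pairwise
adjacent vertices contains a `k`-clique). [cite: Karp1972, §4 Main Theorem, problem 3] -/
theorem exists_vector_iff_not_cliqueFree {n : ℕ} (H : SimpleGraph (Fin n)) (k : ℕ) :
    (∃ y : List Bool, y.length = n ∧ k ≤ y.count true ∧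
      ∀ i j : Fin n, y.getD i false = true → y.getD j false = true → i ≠ j → H.Adj i j) ↔
      ¬ H.CliqueFree k := by
  classical
  constructor
  · rintro ⟨y, hlen, hk, hpairs⟩ hfree
    set S : Finset (Fin n) := univ.filter fun i => y.getD i false = true with hS
    have hclique : H.IsClique (S : Set (Fin n)) := by
      intro i hi j hj hij
      rw [Finset.mem_coe, hS, Finset.mem_filter] at hi hj
      exact hpairs i j hi.2 hj.2 hij
    have hcard : k ≤ S.card := by
      rw [hS, ← CliqueNP.count_true_ofFn (fun i : Fin n => y.getD i false), CliqueNP.ofFn_getD hlen]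
      exact hk
    obtain ⟨s, hsS, hs⟩ := Finset.exists_subset_card_eq hcard
    exact hfree s ⟨hclique.subset (Finset.coe_subset.2 hsS), hs⟩
  · intro hcl
    obtain ⟨s, hs⟩ : ∃ s, H.IsNClique k s := by simpa [SimpleGraph.CliqueFree] using hcl
    refine ⟨List.ofFn fun i : Fin n => decide (i ∈ s), List.length_ofFn, ?_, ?_⟩
    · rw [CliqueNP.count_true_ofFn]
      have hS : (univ.filter fun i : Fin n => decide (i ∈ s) = true) = s := by
        ext i; simp
      rw [hS, hs.card_eq]
    · intro i j hi hj hij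
      rw [CliqueNP.getD_ofFn] at hi hj
      exact hs.isClique (Finset.mem_coe.2 (of_decide_eq_true hi)) (Finset.mem_coe.2 (of_decide_eq_true hj)) hij

/-! ### The verifier on codes -/

/-- **The clique-or-independent-set verifier is computed on codes by a polynomial-time string
function.** On `((n, bits), y)` (code `⟨⟨bin n, bits⟩, y⟩`): accept iff `|y| = n`,
`Nat.size (n·n − 1) ≤ #1(y)` and, for `pol = 1` or for `pol = 0`, every two distinct chosen vertices
have adjacency bit `pol`. [cite: AroraBarak2009, Def. 2.1, §1.3] -/
theorem chk_codeFP :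
    CodeFP (pairE (pairE natE strE) strE) bitE (fun q : (ℕ × List Bool) × List Bool =>
      decide (q.2.length = q.1.1) && (decide (Nat.size (q.1.1 * q.1.1 - 1) ≤ q.2.count true) &&
        (((List.range q.1.2.length).all fun t =>
            !(q.2.getD (t / q.1.1) false && (q.2.getD (t % q.1.1) false && !decide (t / q.1.1 = t % q.1.1))) ||
              (q.1.2.getD t false == true)) ||
          ((List.range q.1.2.length).all fun t =>
            !(q.2.getD (t / q.1.1) false && (q.2.getD (t % q.1.1) false && !decide (t / q.1.1 = t % q.1.1))) ||
              (q.1.2.getD t false == false))))) := by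
  -- projections of the input `q = ((n, bits), y)`
  have hn : CodeFP (pairE (pairE natE strE) strE) natE (fun q : (ℕ × List Bool) × List Bool => q.1.1) :=
    (fst _ _).fst'
  have hbits : CodeFP (pairE (pairE natE strE) strE) strE (fun q : (ℕ × List Bool) × List Bool => q.1.2) :=
    (fst _ _).snd'
  have hy : CodeFP (pairE (pairE natE strE) strE) strE (fun q : (ℕ × List Bool) × List Bool => q.2) :=
    snd _ _
  -- numerals: the threshold and the two header tests
  have hcnt : CodeFP strE natE (fun y : List Bool => y.count true) :=
    of_fn HashBricks.popCountFn HashBricks.popCountFn_mem_FP fun y => HashBricks.popCountFn_apply y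
  have hsize : CodeFP natE natE Nat.size := (strNatLength.comp strOfNat).congr fun m => length_natE m
  have hk : CodeFP (pairE (pairE natE strE) strE) natE
      (fun q : (ℕ × List Bool) × List Bool => Nat.size (q.1.1 * q.1.1 - 1)) :=
    hsize.comp (natSub.comp ((natMul.comp (hn.pair hn)).pair (const _ 1)))
  have h1 : CodeFP (pairE (pairE natE strE) strE) bitE
      (fun q : (ℕ × List Bool) × List Bool => decide (q.2.length = q.1.1)) :=
    natEq.comp ((strNatLength.comp hy).pair hn)
  have h2 : CodeFP (pairE (pairE natE strE) strE) bitE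
      (fun q : (ℕ × List Bool) × List Bool => decide (Nat.size (q.1.1 * q.1.1 - 1) ≤ q.2.count true)) :=
    natLe.comp (hk.pair (hcnt.comp hy))
  -- the piece of the pair test at `(q, t)`
  have gn : CodeFP (pairE (pairE (pairE natE strE) strE) natE) natE
      (fun r : ((ℕ × List Bool) × List Bool) × ℕ => r.1.1.1) := hn.comp (fst _ _)
  have gbits : CodeFP (pairE (pairE (pairE natE strE) strE) natE) strE
      (fun r : ((ℕ × List Bool) × List Bool) × ℕ => r.1.1.2) := hbits.comp (fst _ _)
  have gy : CodeFP (pairE (pairE (pairE natE strE) strE) natE) strE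
      (fun r : ((ℕ × List Bool) × List Bool) × ℕ => r.1.2) := hy.comp (fst _ _)
  have gt : CodeFP (pairE (pairE (pairE natE strE) strE) natE) natE
      (fun r : ((ℕ × List Bool) × List Bool) × ℕ => r.2) := snd _ _
  have gi : CodeFP (pairE (pairE (pairE natE strE) strE) natE) natE
      (fun r : ((ℕ × List Bool) × List Bool) × ℕ => r.2 / r.1.1.1) := natDiv.comp (gt.pair gn)
  have gj : CodeFP (pairE (pairE (pairE natE strE) strE) natE) natE
      (fun r : ((ℕ × List Bool) × List Bool) × ℕ => r.2 % r.1.1.1) := natMod.comp (gt.pair gn)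
  have gyi : CodeFP (pairE (pairE (pairE natE strE) strE) natE) bitE
      (fun r : ((ℕ × List Bool) × List Bool) × ℕ => r.1.2.getD (r.2 / r.1.1.1) false) :=
    strGetDNat.comp (gy.pair gi)
  have gyj : CodeFP (pairE (pairE (pairE natE strE) strE) natE) bitE
      (fun r : ((ℕ × List Bool) × List Bool) × ℕ => r.1.2.getD (r.2 % r.1.1.1) false) :=
    strGetDNat.comp (gy.pair gj)
  have gd : CodeFP (pairE (pairE (pairE natE strE) strE) natE) bitE
      (fun r : ((ℕ × List Bool) × List Bool) × ℕ => decide (r.2 / r.1.1.1 = r.2 % r.1.1.1)) :=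
    natEq.comp (gi.pair gj)
  have gb : CodeFP (pairE (pairE (pairE natE strE) strE) natE) bitE
      (fun r : ((ℕ × List Bool) × List Bool) × ℕ => r.1.1.2.getD r.2 false) :=
    strGetDNat.comp (gbits.pair gt)
  have gP : ∀ pol : Bool, CodeFP (pairE (pairE (pairE natE strE) strE) natE) bitE
      (fun r : ((ℕ × List Bool) × List Bool) × ℕ =>
        !(r.1.2.getD (r.2 / r.1.1.1) false && (r.1.2.getD (r.2 % r.1.1.1) false &&
            !decide (r.2 / r.1.1.1 = r.2 % r.1.1.1))) || (r.1.1.2.getD r.2 false == pol)) := fun pol =>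
    (gyi.and (gyj.and gd.not)).not.or ((beq bitE_injective).comp (gb.pair (const _ pol)))
  -- the fold over the flat indices `t < |bits|`
  have hrange : CodeFP (pairE (pairE natE strE) strE) (rawE natE)
      (fun q : (ℕ × List Bool) × List Bool => List.range q.1.2.length) :=
    urange.comp (strLength.comp hbits)
  have h3 : ∀ pol : Bool, CodeFP (pairE (pairE natE strE) strE) bitE
      (fun q : (ℕ × List Bool) × List Bool => (List.range q.1.2.length).all fun t =>
        !(q.2.getD (t / q.1.1) false && (q.2.getD (t % q.1.1) false && !decide (t / q.1.1 = t % q.1.1))) ||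
          (q.1.2.getD t false == pol)) := fun pol =>
    (all (gP pol)).comp ((CodeFP.id _).pair hrange)
  exact h1.and (h2.and ((h3 true).or (h3 false)))

end RamseyUncertifiableRamseyInCoNP

open RamseyUncertifiableRamseyInCoNP in
/-- **RAMSEY₂ ∈ coNP** (item `stmt-PneNP-9819`): the language of adjacency codes of graphs on
`Fin n` with no clique and no independent set of size `Nat.clog 2 (n²)` is in `coNP` — its
complement consists of the non-codewords (a `P` language) and the codes of graphs carrying a
homogeneous `Nat.clog 2 (n²)`-set (an `NP` certificate language).
[cite: AroraBarak2009, Def. 2.1 and Def. 2.19–2.20, §2.6.1] [cite: Karp1972, §4 Main Theorem, problem 3] -/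
theorem ramseyInCoNP_proof : Summit.PneNP.PneNP.Theses.RamseyUncertifiable.RamseyInCoNP := by
  classical
  unfold Summit.PneNP.PneNP.Theses.RamseyUncertifiable.RamseyInCoNP
  rw [coNP, co, Set.mem_setOf_eq]
  -- the verifier and its certificate language
  obtain ⟨f, hf, hfspec⟩ := chk_codeFP
  set V : Language Bool := {w | f w = [true]} with hV
  have hVP : V ∈ Classes.P := setOf_apply_eq_apply_mem_P hf (const_mem_FP [true])
  set W : Language Bool :=
    {x | ∃ y : List Bool, y.length ≤ (X : Polynomial ℕ).eval x.length ∧ boolPair x y ∈ V} with hW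
  have hWNP : W ∈ Nondeterministic.NP := ⟨V, hVP, X, fun _ => Iff.rfl⟩
  -- the certificate language on the code of a graph
  have key : ∀ (n : ℕ) (G : SimpleGraph (Fin n)), encodingGraph.encode ⟨n, G⟩ ∈ W ↔
      ¬ (G.CliqueFree (Nat.clog 2 (n ^ 2)) ∧ Gᶜ.CliqueFree (Nat.clog 2 (n ^ 2))) := by
    intro n G
    have hE : ∀ y : List Bool, boolPair (encodingGraph.encode ⟨n, G⟩) y =
        pairE (pairE natE strE) strE ((n, CliqueNP.adjBits n G), y) := fun y => by
      rw [HamNP.encode_eq]; rfl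
    have hacc : ∀ y : List Bool, boolPair (encodingGraph.encode ⟨n, G⟩) y ∈ V ↔
        y.length = n ∧ Nat.clog 2 (n ^ 2) ≤ y.count true ∧
          ((∀ i j : Fin n, y.getD i false = true → y.getD j false = true → i ≠ j → G.Adj i j) ∨
            (∀ i j : Fin n, y.getD i false = true → y.getD j false = true → i ≠ j → Gᶜ.Adj i j)) := by
      intro y
      rw [hV]
      change f (boolPair (encodingGraph.encode ⟨n, G⟩) y) = [true] ↔ _
      rw [hE, hfspec]
      simp only [bitE, List.cons.injEq, and_true, Bool.and_eq_true, Bool.or_eq_true, decide_eq_true_eq,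
        CliqueNP.length_adjBits, size_mul_self_pred]
      rw [all_range_iff, all_range_iff]
      simp only [CliqueNP.getD_adjBits_flat, decide_eq_true_eq]
      have h2 : (∀ i j : Fin n, y.getD i false = true → y.getD j false = true → i ≠ j → decide (G.Adj i j) = false) ↔
          ∀ i j : Fin n, y.getD i false = true → y.getD j false = true → i ≠ j → Gᶜ.Adj i j := by
        simp only [decide_eq_false_iff_not, SimpleGraph.compl_adj]
        exact ⟨fun h i j hi hj hij => ⟨hij, h i j hi hj hij⟩, fun h i j hi hj hij => (h i j hi hj hij).2⟩
      rw [h2]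
    have hn : n ≤ (encodingGraph.encode ⟨n, G⟩).length :=
      (Nat.le_mul_self n).trans ((Nat.le_add_right _ 2).trans (HamNP.nsq_add_two_le_length_encode n G))
    rw [hW]
    change (∃ y : List Bool, y.length ≤ (X : Polynomial ℕ).eval (encodingGraph.encode ⟨n, G⟩).length ∧
      boolPair (encodingGraph.encode ⟨n, G⟩) y ∈ V) ↔ _
    simp only [hacc, eval_X]
    rw [not_and_or, ← exists_vector_iff_not_cliqueFree G, ← exists_vector_iff_not_cliqueFree Gᶜ]
    constructor
    · rintro ⟨y, -, hlen, hk, h | h⟩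
      · exact Or.inl ⟨y, hlen, hk, h⟩
      · exact Or.inr ⟨y, hlen, hk, h⟩
    · rintro (⟨y, hlen, hk, h⟩ | ⟨y, hlen, hk, h⟩)
      · exact ⟨y, hlen ▸ hn, hlen, hk, Or.inl h⟩
      · exact ⟨y, hlen ▸ hn, hlen, hk, Or.inr h⟩
  -- the complement is `gcodeLangᶜ ⊔ W`
  have heq : (encodingGraph.toLanguage {p : Σ n, SimpleGraph (Fin n) |
      p.2.CliqueFree (Nat.clog 2 (p.1 ^ 2)) ∧ p.2ᶜ.CliqueFree (Nat.clog 2 (p.1 ^ 2))})ᶜ =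
      HamNP.gcodeLangᶜ ⊔ W := by
    ext x
    change x ∉ _ ↔ x ∉ HamNP.gcodeLang ∨ x ∈ W
    constructor
    · intro hx
      by_cases hc : x ∈ HamNP.gcodeLang
      · obtain ⟨n, G, rfl⟩ := (HamNP.mem_gcodeLang_iff x).1 hc
        refine Or.inr ((key n G).2 fun hR => hx ?_)
        exact (Encoding.mem_toLanguage_iff _ _ _).2 hR
      · exact Or.inl hc
    · rintro (hc | hw) hx
      · obtain ⟨⟨n, G⟩, -, rfl⟩ := hx
        exact hc ((HamNP.mem_gcodeLang_iff _).2 ⟨n, G, rfl⟩)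
      · obtain ⟨⟨n, G⟩, hp, rfl⟩ := hx
        exact (key n G).1 hw hp
  rw [heq]
  exact union_P_mem_polyExists (K := Classes.P) (fun _ _ a b => union_mem_P a b)
    (compl_mem_P_iff.2 HamNP.gcodeLang_mem_P) hWNP

end Summit.PneNP.PneNP.Theorems
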